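import Literature.NumberTheory.EllipticCurves.Darmon2004.HeegnerPointReflection
import Literature.NumberTheory.EllipticCurves.HeegnerPointsKolyvaginEulerSystem
import HarnessLib

/-!
# Darmon 2004, Proposition 3.11 — proved unfoldings and the bridge to the Summits-side binder `h53`

Companion of `Darmon2004/HeegnerPointReflection.lean` (the statement-only named fact
`prop311_complexConjugation`: a complex-conjugation reflection acts on the Heegner points of conductor
`n` as `−sign(E,ℚ)` times a `Gal(H_n/K)`-conjugate modulo torsion; Darmon 2004 Prop. 3.11 = Gross
1991 Prop. 5.3). Everything here is PROVED (no new fact, no definition, no `sorry`):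

* `prop311_complexConjugation.apply` — the fact at one curve / field / level / point;
* `y_mem_heegnerPointSet` — the point `y(n)` of a Kolyvagin–Heegner datum lies in Darmon's `HP(n)`
  (witness: the Heegner form of conductor `n`, `heegnerFormOfConductor_mem_heegnerForms`, and
  `d.map_y`);
* `prop311_complexConjugation.h53` — **the bridge to the binder `h53`** of the Kolyvagin assemblies
  (`X11b.KolyvaginAssembly.hpoints_at_of_perLevelChoice`, `SylvesterTwoUpper.…_of_h44`,
  `P2.PointSystemHloc.…_of_hloc`, `CMPointSystemTwo`, `PointSystemOddTamagawa`, `CMLevelZeroTwo`): at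
  `N = N_E`, for every prime `p`, every Kolyvagin level (its prime factors are prime to `N`) and every
  level of a Kolyvagin–Heegner tower, VERBATIM the binder's type — so those theorems' `h53` is fed by
  `(h : prop311_complexConjugation).h53 hN`.

References: [Darmon2004] Prop. 3.11 (p. 36), §3.4 (p. 35); [GrossLMS1991] §3, Prop. 5.3 (p. 243).
-/

noncomputable section

open scoped Classical

open NumberField WeierstrassCurve
open Literature.NumberTheory.EllipticCurves.ModularForms
open Literature.NumberTheory.EllipticCurves.KolyvaginEuler

namespace Literature.NumberTheory.EllipticCurves.Darmon2004

/-- Unfolding of `prop311_complexConjugation` at one curve, field, level and point (by definition).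
[cite: Darmon2004, Prop. 3.11 (p. 36)] -/
theorem prop311_complexConjugation.apply (h : prop311_complexConjugation)
    {W : WeierstrassCurve ℚ} [W.IsElliptic] [NeZero (W.conductorNorm ℤ)]
    {K : Type} [Field K] [NumberField K] (hK : IsImaginaryQuadratic K)
    (hH : SatisfiesHeegnerHypothesis (W.conductorNorm ℤ) K) (ι : K →+* ℂ)
    (Dt : ModularParametrizationData W (W.conductorNorm ℤ))
    {n : ℕ} (hn : n ≠ 0) (hnN : Nat.Coprime n (W.conductorNorm ℤ))
    {P : (W.baseChange (ringClassField K ι n)).toAffine.Point} (hP : P ∈ heegnerPointSet ι Dt n)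
    (τ : ringClassField K ι n ≃ₐ[ℚ] ringClassField K ι n)
    (hτ : ∀ x : ringClassField K ι n, ((τ x : ringClassField K ι n) : ℂ) = starRingEnd ℂ x) :
    ∃ σ ∈ ringClassGal ι n, IsOfFinAddOrder
      (pointGalHom W (ringClassField K ι n) τ P -
        (-W.rootNumber) • pointGalHom W (ringClassField K ι n) σ P) :=
  h W K hK hH ι Dt n hn hnN P hP τ hτ

/-- **The point `y(n)` of a Kolyvagin–Heegner datum is a Heegner point of conductor `n` in Darmon's
sense**: `d.y ∈ HP(n)`, witnessed by the Heegner form of conductor `n`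
(`heegnerFormOfConductor d_K β n ∈ heegnerForms N (n² d_K)`, `heegnerFormOfConductor_mem_heegnerForms`)
and `d.map_y : y(n) ↦ Φ_N(x(n))`. [cite: Darmon2004, §3.4 (p. 35), HP(n)]
[cite: GrossLMS1991, §3 (the points x_n, y_n)] -/
theorem y_mem_heegnerPointSet {K : Type} [Field K] [NumberField K]
    (hK : IsImaginaryQuadratic K) {ι : K →+* ℂ} {N : ℕ} [NeZero N] {W : WeierstrassCurve ℚ}
    {Dt : ModularParametrizationData W N} {β : ℤ} {n : ℕ} (hn : n ≠ 0)
    (d : KolyvaginHeegnerData Dt β ι n) : d.y ∈ heegnerPointSet ι Dt n :=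
  ⟨heegnerFormOfConductor (NumberField.discr K) β n,
    (heegnerFormOfConductor_mem_heegnerForms hK.discr_neg d.dvd_sq_sub hn).1, d.map_y⟩

/-- **Bridge to the Summits-side binder `h53` (Gross 1991, Prop. 5.3 in the shape consumed by the
Kolyvagin assemblies `X11b.KolyvaginAssembly.hpoints_at_of_perLevelChoice`,
`SylvesterTwoUpper.…_of_h44`, `P2.PointSystemHloc.…_of_hloc`, `CMPointSystemTwo`,
`PointSystemOddTamagawa`, `CMLevelZeroTwo`)**: at the conductor `N = N_E`, for every prime `p`,
every Kolyvagin level `n` at `p^M` (square-free product of Kolyvagin primes — each is prime to `N`)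
and every level `m ∣ n` of a Kolyvagin–Heegner tower, complex conjugation on `y(m)` is
`−w(E) × (a Gal(K[m]/K)-conjugate)` up to torsion. The extra binders of that shape (`M`, the
Kolyvagin conditions) are not used beyond `gcd(m, N) = 1`. [cite: Darmon2004, Prop. 3.11 (p. 36)]
[cite: GrossLMS1991, Prop. 5.3 (p. 243)] -/
theorem prop311_complexConjugation.h53 (h : prop311_complexConjugation)
    {K : Type} [Field K] [NumberField K] {N : ℕ} [NeZero N] {W : WeierstrassCurve ℚ}
    (hN : N = W.conductorNorm ℤ) {p : ℕ} :
    ∀ [W.IsElliptic] (_hK : IsImaginaryQuadratic K) (_hH : SatisfiesHeegnerHypothesis N K)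
      (Dt : ModularParametrizationData W N) (β : ℤ) (ι : K →+* ℂ) {M : ℕ}
      (_hM : 1 ≤ M) {n : ℕ} (_hn : Squarefree n)
      (_hKol : ∀ q ∈ n.primeFactors, IsKolyvaginPrime N W K p q ∧ FrobEqFrobInfty W K (p ^ M) q)
      (d : (m : ℕ) → m ∣ n → KolyvaginHeegnerData Dt β ι m) (m : ℕ) (hm : m ∣ n)
      (τm : ringClassField K ι m ≃ₐ[ℚ] ringClassField K ι m),
      (∀ x : ringClassField K ι m, ((τm x : ringClassField K ι m) : ℂ) = starRingEnd ℂ x) →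
      ∃ σ' ∈ ringClassGal ι m, IsOfFinAddOrder
        (pointGalHom W (ringClassField K ι m) τm (d m hm).y -
          (-W.rootNumber) • pointGalHom W (ringClassField K ι m) σ' (d m hm).y) := by
  subst hN
  intro _ hK hH Dt β ι M _ n hn hKol d m hm τm hτm
  have hm0 : m ≠ 0 := ne_zero_of_dvd_ne_zero (Squarefree.ne_zero hn) hm
  -- every prime factor of `m ∣ n` is a Kolyvagin prime, hence prime to `N`
  have hcop : Nat.Coprime m (W.conductorNorm ℤ) := Nat.coprime_of_dvd fun q hq hqm hqN ↦
    (hKol q (Nat.mem_primeFactors.mpr ⟨hq, hqm.trans hm, Squarefree.ne_zero hn⟩)).1.2.1 hqN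
  exact h W K hK hH ι Dt m hm0 hcop (d m hm).y
    (y_mem_heegnerPointSet hK hm0 (d m hm)) τm hτm

end Literature.NumberTheory.EllipticCurves.Darmon2004

end
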